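import Summits.CriticalPhenomena.Ising3DConformalLimit.Theorems.ExistsScaleCovariantLimit.Negative.DyadicIdentity
import HarnessLib

/-!
# Limits of the pinned zoom at geometric axis pairs are positive
(line `Sketch` of the crux `ExistsScaleCovariantLimit`, item stmt-CriticalPhenomena-1981;
stub `stub_geomPairLimit_pos`, glue P)

The pinned zoom of the critical `ℤ³` Ising correlators is
`F_n(δ)(x) = rescaledCorrelator (criticalCorr 3) rhoPin n δ x`. Write
`g(m) = ⟨σ₀σ_{m e₁}⟩_{β_c}` for the axis two-point function. At the mesh `δ = b^{-j}` and the axis pair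
`(0, b^a e₀)` the lattice approximations are exact, so `F₂(b^{-j})(0, b^a e₀) = g(b^{a+j}) / g(b^j)`,
a number in `(0, 1]`. If these ratios converge to `L` as `j → ∞` then `L > 0`: otherwise eventually
`g(b^{a+j}) ≤ θ g(b^j)` with `θ = b^{-2a}/2`, and iterating along `j = j₀ + a k` gives
`g(b^{j₀ + a k}) ≤ θ^k`, against the Simon–Lieb lower bound `g(m) ≥ c m^{-2}` (tree theorem
`criticalTwoPoint_bounds_holds`), which gives `g(b^{j₀ + a k}) ≥ c b^{-2 j₀} (b^{-2a})^k`, i.e.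
`c b^{-2j₀} ≤ 2^{-k}` for all `k`. No named facts. [folklore]
-/

noncomputable section

namespace Summit.CriticalPhenomena.Ising3DConformalLimit.Cruxes.ExistsScaleCovariantLimit.TwoHierarchies

open Literature.Probability.LatticeModels Filter Set
open scoped Topology
open Summit.CriticalPhenomena.Ising3DConformalLimit.MoebiusLimitExistsOnlyInteraction (rhoPin)
open Summit.CriticalPhenomena.Ising3DConformalLimit.ExistsScaleCovariantLimitNegative.Dyadic
  (pz_two_cfg0)
open Summit.CriticalPhenomena.Ising3DConformalLimit.MoebiusLimitExistsNegative (chain_le_pow)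

/-- Simon–Lieb on the axis of `ℤ³`, nat-power form: `c / m² ≤ ⟨σ₀σ_{m e₁}⟩_{β_c}` for `m ≥ 1`
(tree theorem `criticalTwoPoint_bounds_holds`). [folklore] -/
theorem criticalTwoPoint_axis_sq_lower : ∃ c : ℝ, 0 < c ∧ ∀ m : ℕ, 1 ≤ m →
    c / (m : ℝ) ^ 2 ≤ criticalTwoPoint 3 (Pi.single 0 (m : ℤ)) := by
  obtain ⟨c, C, hc, hb⟩ := criticalTwoPoint_bounds_holds (d := 3) le_rfl
  refine ⟨c, hc, fun m hm => ?_⟩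
  have hm0 : (0 : ℝ) < m := by exact_mod_cast hm
  have hx : (Pi.single 0 (m : ℤ) : Site 3) ≠ 0 := by
    intro h0
    have := congr_fun h0 0
    simp only [Pi.single_eq_same, Pi.zero_apply] at this
    omega
  have h1 := (hb _ hx).1
  rw [norm_single_axis, Int.cast_natCast, abs_of_pos hm0,
    show (-(((3 : ℕ) : ℝ) - 1)) = -(2 : ℝ) by norm_num, Real.rpow_neg hm0.le, Real.rpow_two,
    ← div_eq_mul_inv] at h1
  exact h1

/-- The pinned zoom at the mesh `b^{-j}` and the axis pair `(0, b^a e₀)` is the exact lattice ratio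
`g(b^{a+j}) / g(b^j)`. [folklore] -/
theorem pz_two_geomPair (b a j : ℕ) :
    rescaledCorrelator (criticalCorr 3) rhoPin 2 (((b : ℝ) ^ j)⁻¹)
        (![0, EuclideanSpace.single 0 ((b : ℝ) ^ a)] : Fin 2 → EuclideanSpace ℝ (Fin 3)) =
      criticalTwoPoint 3 (Pi.single 0 ((b ^ (a + j) : ℕ) : ℤ)) /
        criticalTwoPoint 3 (Pi.single 0 ((b ^ j : ℕ) : ℤ)) := by
  have h1 : (b : ℝ) ^ a / ((b : ℝ) ^ j)⁻¹ = ((b ^ (a + j) : ℕ) : ℝ) := by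
    rw [div_inv_eq_mul, ← pow_add, Nat.cast_pow]
  have h2 : 1 / ((b : ℝ) ^ j)⁻¹ = ((b ^ j : ℕ) : ℝ) := by
    rw [one_div, inv_inv, Nat.cast_pow]
  rw [pz_two_cfg0, h1, h2, Int.floor_natCast, Int.floor_natCast]

/-- **P — glue: limits of the pinned zoom at geometric axis pairs are positive.** If
`F₂(b^{-j})(0, b^a e₀) → L` (`b ≥ 2`) then `0 < L`, by the chain argument against the Simon–Lieb
lower bound `⟨σ₀σ_{m e₁}⟩_{β_c} ≥ c m^{-2}`. [folklore] -/
theorem stub_geomPairLimit_pos :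
    ∀ b : ℕ, 2 ≤ b → ∀ (a : ℕ) (L : ℝ),
      Tendsto (fun j : ℕ => rescaledCorrelator (criticalCorr 3) rhoPin 2 (((b:ℝ) ^ j)⁻¹)
        (![0, EuclideanSpace.single 0 ((b:ℝ) ^ a)] : Fin 2 → EuclideanSpace ℝ (Fin 3))) atTop (𝓝 L) →
      0 < L := by
  intro b hb a L hL
  set g : ℕ → ℝ := fun m => criticalTwoPoint 3 (Pi.single 0 (m : ℤ)) with hg
  have hgpos : ∀ m, 0 < g m := criticalTwoPoint_axis_pos
  have hL' : Tendsto (fun j : ℕ => g (b ^ (a + j)) / g (b ^ j)) atTop (𝓝 L) :=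
    hL.congr fun j => pz_two_geomPair b a j
  by_contra hL0
  rw [not_lt] at hL0
  obtain ⟨c, hc, hlow⟩ := criticalTwoPoint_axis_sq_lower
  have hb0 : (0 : ℝ) < b := by exact_mod_cast (by omega : 0 < b)
  -- the ratio threshold `θ = b^{-2a} / 2`
  set S : ℝ := ((b : ℝ) ^ a) ^ 2 with hS
  have hS0 : 0 < S := by positivity
  set θ : ℝ := S⁻¹ * (1 / 2) with hθ
  have hθ0 : 0 < θ := by positivity
  have hev : ∀ᶠ j in atTop, g (b ^ (a + j)) / g (b ^ j) < θ :=
    hL' (Iio_mem_nhds (hL0.trans_lt hθ0))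
  obtain ⟨j₀, hj₀⟩ := eventually_atTop.1 hev
  -- the chain `G k = g(b^(j₀ + a k))` decays geometrically with ratio `θ`
  set G : ℕ → ℝ := fun k => g (b ^ (j₀ + a * k)) with hG
  have hstep : ∀ k, G (k + 1) ≤ θ * G k := by
    intro k
    have h := hj₀ (j₀ + a * k) (Nat.le_add_right _ _)
    rw [div_lt_iff₀ (hgpos _), show a + (j₀ + a * k) = j₀ + a * (k + 1) by ring] at h
    exact h.le
  have hchain : ∀ k, G k ≤ θ ^ k := chain_le_pow hθ0.le (criticalTwoPoint_le_one' _) hstep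
  -- Simon–Lieb along the chain: `c b^{-2j₀} (S⁻¹)^k ≤ G k`
  have hlo : ∀ k, c / ((b : ℝ) ^ j₀) ^ 2 * S⁻¹ ^ k ≤ G k := by
    intro k
    have h := hlow (b ^ (j₀ + a * k)) (Nat.one_le_pow _ _ (by omega))
    have e : ((b ^ (j₀ + a * k) : ℕ) : ℝ) ^ 2 = ((b : ℝ) ^ j₀) ^ 2 * S ^ k := by
      push_cast
      ring
    calc c / ((b : ℝ) ^ j₀) ^ 2 * S⁻¹ ^ k = c / (((b ^ (j₀ + a * k) : ℕ) : ℝ) ^ 2) := by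
          rw [e, inv_pow, ← div_eq_mul_inv, div_div]
      _ ≤ G k := h
  -- hence `c b^{-2j₀} ≤ 2^{-k}` for every `k`: absurd
  have hfin : ∀ k : ℕ, c / ((b : ℝ) ^ j₀) ^ 2 ≤ (1 / 2) ^ k := by
    intro k
    have h1 := (hlo k).trans (hchain k)
    rw [hθ, mul_pow, mul_comm (S⁻¹ ^ k)] at h1
    exact le_of_mul_le_mul_right h1 (pow_pos (inv_pos.2 hS0) k)
  have hK : 0 < c / ((b : ℝ) ^ j₀) ^ 2 := by positivity
  obtain ⟨k, hk⟩ := exists_pow_lt_of_lt_one hK (by norm_num : (1 / 2 : ℝ) < 1)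
  exact absurd (hfin k) (not_le.2 hk)

end Summit.CriticalPhenomena.Ising3DConformalLimit.Cruxes.ExistsScaleCovariantLimit.TwoHierarchies

end
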